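import Mathlib
import Literature.MathematicalPhysics.QuantumFieldTheory.Luscher2010.TrivializingMaps
import Literature.MathematicalPhysics.QuantumFieldTheory.Luscher2010.FlowActionSeries
import Literature.MathematicalPhysics.QuantumFieldTheory.Luscher2010.FlowExistenceProofs
import Literature.Probability.MarkovChains.DoeblinMinorization
import Summits.Ventures.LatticeQCDFlow.TrivializingMaps.Truncation
import Summits.Ventures.LatticeQCDFlow.TrivializingMaps.TruncationDefect
import Summits.Ventures.LatticeQCDFlow.TrivializingMaps.TruncatedMapLogWeight
import Summits.Ventures.LatticeQCDFlow.TrivializingMaps.DefectLogWeightMeasure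
import Summits.Ventures.LatticeQCDFlow.TrivializingMaps.SeriesUniqueness
import Summits.Ventures.LatticeQCDFlow.TrivializingMaps.WilsonPolynomials
import Summits.Ventures.LatticeQCDFlow.TrivializingMaps.LuscherSeriesExistence
import Summits.Ventures.LatticeQCDFlow.TrivializingMaps.ExtensiveDefect
import Summits.Ventures.LatticeQCDFlow.Exactness.ApproxTrivializingSampler
import HarnessLib

/-!
# The exact order-`N` Wilson-flow sampler: acceptance and mixing floor `e^{-2|β|^{N+2} b_N |E|/(N+2)}`

HONEST FRAMING: exact (Metropolis-corrected) sampling algorithms for lattice gauge theory; figures of merit are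
autocorrelation/cost numbers at stated couplings and volumes; no continuum-physics claim.

Venture `LatticeQCDFlow` (cell pub-lqcd), topic `TrivializingMaps`, FANOUT row 28 (theory-1), route R-T1
(Lüscher's perturbative trivializing maps; typed targets of `Truncation.lean`).  This file ASSEMBLES the
cell's chain into one unconditional statement about an ALGORITHM, at every coupling `β`, every volume `L^d`
(periodic, `L ≥ 1`), every `SU(n)` and every truncation order `N`:

* the sampler: draw `V ∼ D[V]` (Haar), push it through the time-one map `𝓕_1` of the flow
  `U̇_t = Z_t(U_t)`, `Z_t = -∂S̃^{[N]}_t`, `S̃^{[N]}_t = ∑_{k≤N} t^k S̃^{(k)}` the order-`N` truncation of ANY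
  smooth solution `S̃^{(k)}` of Lüscher's recursion (4.12)–(4.13) for the action `β S_W` (Wilson plaquette
  action `S_W = ambWilsonAction`), and Metropolis-correct the proposal law `q = (𝓕_1)_* D[V]` against
  `π_β = 𝒵⁻¹ e^{-β S_W} D[U]` with the independence kernel `indepMH q w`, `w = dπ_β/dq`;
* the guarantee (`truncatedWilsonFlowSampler`): there is `b = b_N(d, n) ≥ 0`, INDEPENDENT of `β, L, B` and of
  the chosen solution, such that with `M := 2 |β|^{N+2} b |E| / (N+2)` (`|E| = d L^d` links) the kernel is EXACT
  (`π_β`-invariant), `e^{-M} ≤ w ≤ e^{M}`, it accepts from EVERY configuration with probability `≥ e^{-M}`,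
  satisfies Doeblin's minorisation `K(U, ·) ≥ e^{-M} π_β` and hence `|μKᵗ(A) - π_β(A)| ≤ (1 - e^{-M})ᵗ` from
  every initial law `μ`;
* existence (`exists_truncatedWilsonFlowSampler`): such a flow `𝓕` exists (global, jointly continuous;
  `Luscher2010.flowGlobalExistence_holds`), for the constructed series `β^{k+1} S̃_W^{(k)}`
  (`wilsonSk`, `LuscherSeriesExistence.lean`), so the guarantee is not vacuous.

Inputs, all tree theorems: the volume law `extensiveDefect_holds` (`sup |𝓥 S̃^{(N)}| ≤ b_N |E|`,
`ExtensiveDefect.lean`), uniqueness of gradients of smooth Lüscher series (`IsLuscherSeries.luscherV_eq`),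
homogeneity in `β` (`IsLuscherSeries.smul`: the series of `β S` is `β^{k+1} S̃^{(k)}`, so the order-`N` defect
density scales as `β^{N+2}` — `luscherV_smul_pow`), the defect identity and log-weight oscillation bound of the
truncated map (`abs_truncation_defect_le`, `logWeight_osc_le_of_defect_le`, `TruncatedMapLogWeight.lean`),
the exact-sampler / Doeblin package (`Exactness.flowSampler_exact_doeblin_of_osc`, lean-1) with the Jacobian
formula (3.9) (`jacobianFormula_holds`, lean-2) and Doeblin's theorem
(`Literature.Probability.MarkovChains.Doeblin.doeblin_iterate_sub_invariant_le`).

What this says about cost (the venture's theory question "how must cost scale with volume at fixed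
acceptance"): at fixed order `N` and coupling `β` the CERTIFIED acceptance / mixing floor of the exact order-`N`
Wilson-flow sampler decays like `exp(-c |E|)` with `c = 2|β|^{N+2} b_N/(N+2)` — an extensive exponent, the
formal counterpart of Lüscher's remark that the residual action `S(𝓕_1 V) - ln det 𝓕_1^*(V)` of a truncated
map is an extensive quantity (§4.5(c), §6).  It is a one-sided statement (a floor): that the acceptance of
volume-uniform maps MUST degrade extensively is the separate lower-bound line of the cell (theory-2,
`Scaling/*`), not claimed here.  The constants `b_N` are compactness constants (no size claim).

References: M. Lüscher, Commun. Math. Phys. 293 (2010) 899–919 [Luscher2010Trivializing, arXiv:0907.5491],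
§3 eqs. (3.4)–(3.9), §4 eqs. (4.4)–(4.17), §4.5(b)(c), §6; S. Meyn, R. Tweedie, Markov Chains and Stochastic
Stability (2009), Thm 16.2.4 (Doeblin ⇒ uniform ergodicity).  Printed counterparts named only.
-/

namespace Summit.Ventures.LatticeQCDFlow.TrivializingMaps

open MeasureTheory ProbabilityTheory
open Literature.MathematicalPhysics.QuantumFieldTheory
open Literature.MathematicalPhysics.QuantumFieldTheory.Luscher2010
open Summit.Ventures.LatticeQCDFlow.Exactness
open scoped ENNReal Matrix Matrix.Norms.Frobenius ContDiff

/-! ## §1. Homogeneity in `β`: the order-`N` defect density of `β S` is `β^{N+2}` times that of `S` -/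

section Scaling

variable {d L n : ℕ} [NeZero L]

/-- `𝓥_S f = ∑_{e,a} ∂^a_e S · ∂^a_e f` is symmetric in `S` and `f`. [cite: Luscher2010Trivializing, §4.3 eq. (4.15)] -/
theorem luscherV_comm (B : SuBasis n) (S f : AmbConfig d L n → ℝ) : luscherV B S f = luscherV B f S := by
  funext W
  unfold luscherV
  exact Finset.sum_congr rfl fun e _ => Finset.sum_congr rfl fun a _ => mul_comm _ _

/-- `𝓥` commutes with constant factors in the action slot. [folklore] -/
theorem luscherV_const_mul_left (B : SuBasis n) (a : ℝ) (S f : AmbConfig d L n → ℝ) (W : AmbConfig d L n) :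
    luscherV B (fun W' => a * S W') f W = a * luscherV B S f W := by
  rw [luscherV_comm B (fun W' => a * S W') f, luscherV_const_mul' B f a S W, luscherV_comm B f S]

/-- **`β`-scaling of the truncation defect**: `𝓥_{βS}(β^{N+1} f) = β^{N+2} 𝓥_S f` — with `IsLuscherSeries.smul`
(the Lüscher series of `β S` is `β^{k+1} S̃^{(k)}`) the order-`N` defect density of `β S_W` is `β^{N+2}` times
that of `S_W`. [cite: Luscher2010Trivializing, §4.3 eqs. (4.12)–(4.15), §4.4 eq. (4.17)] -/
theorem luscherV_smul_pow (B : SuBasis n) (S f : AmbConfig d L n → ℝ) (β : ℝ) (N : ℕ) (W : AmbConfig d L n) :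
    luscherV B (fun W' => β * S W') (fun W' => β ^ (N + 1) * f W') W = β ^ (N + 2) * luscherV B S f W := by
  rw [luscherV_const_mul', luscherV_const_mul_left]
  ring

end Scaling

/-! ## §2. The sup-norm of the order-`N` defect density of `β S_W`: `≤ |β|^{N+2} b_N |E|` -/

section Defect

/-- **Uniform defect bound at coupling `β`.**  There is `b = b_N(d,n) ≥ 0` such that for every `β`, every
periodic volume `L ≥ 1`, every orthonormal basis `B` of `𝔰𝔲(n)` and EVERY smooth solution `S̃^{(k)}` of
Lüscher's recursion for `β S_W`: `sup_{SU(n)^E} |𝓥_{βS_W} S̃^{(N)}| ≤ |β|^{N+2} · b · |E|`.  From the volume law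
`extensiveDefect_holds` (at `β = 1`, for the constructed series), uniqueness of gradients of smooth Lüscher
series (`IsLuscherSeries.luscherV_eq`) and `β`-homogeneity. [cite: Luscher2010Trivializing, §4.3, §4.5(b)(c)] -/
theorem exists_truncationDefect_bound (d n N : ℕ) : ∃ b : ℝ, 0 ≤ b ∧
    ∀ (β : ℝ) (L : ℕ) [NeZero L] (B : SuBasis n) (Sk : ℕ → AmbConfig d L n → ℝ) (c : ℕ → ℝ),
      (∀ k, ContDiff ℝ ∞ (Sk k)) → IsLuscherSeries B (fun W => β * ambWilsonAction W) Sk c →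
      ∀ U : GaugeConfig d L (Matrix.specialUnitaryGroup (Fin n) ℂ),
        |luscherV B (fun W => β * ambWilsonAction W) (Sk N) (WilsonFlow.coeConfig U)| ≤
          |β| ^ (N + 2) * b * Fintype.card (Edge d L) := by
  obtain ⟨b₀, hb₀⟩ := extensiveDefect_holds d n N
  refine ⟨max b₀ 0, le_max_right _ _, ?_⟩
  intro β L _ B Sk c hSk hser U
  -- compare with the constructed, `β`-scaled Wilson series `β^{k+1} S̃_W^{(k)}`
  have hser' : IsLuscherSeries B (fun W => β * ambWilsonAction W)
      (fun k W => β ^ (k + 1) * wilsonSk d L B k W) (fun k => β ^ (k + 1) * wilsonConst d L B k) :=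
    (isLuscherSeries_wilsonSk B).smul β
  have hsm' : ∀ k, ContDiff ℝ ∞ (fun W : AmbConfig d L n => β ^ (k + 1) * wilsonSk d L B k W) :=
    fun k => contDiff_const.mul (contDiff_wilsonSk B k)
  rw [IsLuscherSeries.luscherV_eq hser hser' hSk hsm' N U,
    luscherV_smul_pow B ambWilsonAction (wilsonSk d L B N) β N, abs_mul, abs_pow]
  have hW : |luscherV B ambWilsonAction (wilsonSk d L B N) (WilsonFlow.coeConfig U)| ≤
      max b₀ 0 * Fintype.card (Edge d L) :=
    (hb₀ L B (wilsonSk d L B) (wilsonConst d L B) (contDiff_wilsonSk B) (isLuscherSeries_wilsonSk B) U).trans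
      (by gcongr; exact le_max_left _ _)
  calc |β| ^ (N + 2) * |luscherV B ambWilsonAction (wilsonSk d L B N) (WilsonFlow.coeConfig U)|
      ≤ |β| ^ (N + 2) * (max b₀ 0 * Fintype.card (Edge d L)) :=
        mul_le_mul_of_nonneg_left hW (pow_nonneg (abs_nonneg β) _)
    _ = |β| ^ (N + 2) * max b₀ 0 * Fintype.card (Edge d L) := by ring

end Defect

/-! ## §3. The flow of the truncated generator exists (globally, jointly continuously) -/

section Flow

variable {d L n : ℕ} [NeZero L]

/-- **The order-`N` flow exists.**  For smooth orders `S̃^{(k)}` the generator `Z_t = -∂S̃^{[N]}_t` is jointly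
`C¹` and tangent to `SU(n)^E`, so by Lüscher §3.1 (tree theorem `flowGlobalExistence_holds`) it has a global,
jointly continuous flow `𝓕`; `𝓕_1` is measurable and its output law `(𝓕_1)_* D[V]` is a probability measure.
[cite: Luscher2010Trivializing, §3.1, §4.2 eq. (4.4), §4.5(c)] -/
theorem exists_isFlowMap_truncFlowAction (B : SuBasis n) {Sk : ℕ → AmbConfig d L n → ℝ}
    (hSk : ∀ k, ContDiff ℝ ∞ (Sk k)) (N : ℕ) :
    ∃ Φ : ℝ → GaugeConfig d L (Matrix.specialUnitaryGroup (Fin n) ℂ) →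
        GaugeConfig d L (Matrix.specialUnitaryGroup (Fin n) ℂ),
      IsFlowMap (fun t W => -linkGrad B (truncFlowAction Sk t N) W) Φ ∧
      Continuous (fun p : ℝ × GaugeConfig d L (Matrix.specialUnitaryGroup (Fin n) ℂ) => Φ p.1 p.2) ∧
      Measurable (Φ 1) ∧
      IsProbabilityMeasure (Measure.map (Φ 1) (trivialMeasure (Matrix.specialUnitaryGroup (Fin n) ℂ) d L)) := by
  haveI : SecondCountableTopology (Matrix (Fin n) (Fin n) ℂ) :=
    inferInstanceAs (SecondCountableTopology (Fin n → Fin n → ℂ))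
  haveI : SecondCountableTopology (Matrix.specialUnitaryGroup (Fin n) ℂ) :=
    Topology.IsEmbedding.subtypeVal.secondCountableTopology
  have hF := contDiff_truncFlowAction_param hSk N
  obtain ⟨Φ, hΦ, hcont, -⟩ := (flowGlobalExistence_holds : FlowGlobalExistence d L n)
    (fun t W => -linkGrad B (truncFlowAction Sk t N) W)
    (contDiff_one_neg_linkGrad_param B (F := fun t => truncFlowAction Sk t N) hF)
    (isTangent_neg_linkGrad B fun t => truncFlowAction Sk t N)
  have hmeas : Measurable (Φ 1) := (hcont.comp (continuous_const.prodMk continuous_id)).measurable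
  haveI : IsProbabilityMeasure (trivialMeasure (Matrix.specialUnitaryGroup (Fin n) ℂ) d L) := by
    unfold trivialMeasure; infer_instance
  exact ⟨Φ, hΦ, hcont, hmeas, Measure.isProbabilityMeasure_map hmeas.aemeasurable⟩

/-- `2 ∫₀¹ s^{N+1} K ds = 2K/(N+2)`. [folklore] -/
theorem two_mul_intervalIntegral_pow_mul (N : ℕ) (K : ℝ) :
    2 * ∫ s in (0 : ℝ)..1, s ^ (N + 1) * K = 2 * K / (N + 2) := by
  rw [intervalIntegral.integral_mul_const, integral_pow]
  have h : ((N : ℝ) + 1 + 1) ≠ 0 := by positivity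
  field_simp
  push_cast
  ring

end Flow

/-! ## §4. The theorem: exactness, acceptance `≥ e^{-M}`, Doeblin constant `e^{-M}`, geometric mixing,
`M = 2|β|^{N+2} b_N |E|/(N+2)` -/

section Sampler

/-- **The exact order-`N` Wilson-flow sampler at coupling `β` (volume law for acceptance and mixing).**
There is `b = b_N(d,n) ≥ 0` such that for every coupling `β`, every periodic volume `L ≥ 1`, every basis `B`,
every smooth solution `S̃^{(k)}` of Lüscher's recursion (4.12)–(4.13) for `β S_W`, every flow `𝓕` of
`Z_t = -∂S̃^{[N]}_t` with output law `q = (𝓕_1)_* D[V]`, and every `M ≥ 2 |β|^{N+2} b |E| / (N+2)`: there is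
a measurable weight `w` with `e^{-M} ≤ w ≤ e^{M}` and `w · q = π_β := 𝒵⁻¹e^{-βS_W} D[U]` such that the
independence Metropolis kernel `K = indepMH q w` ("propose from the flow, accept with `min(1, w(U')/w(U))`")
(i) leaves `π_β` invariant (EXACT), (ii) accepts from every configuration with probability `≥ e^{-M}`,
(iii) satisfies Doeblin `K(U, ·) ≥ e^{-M} π_β(·)`, and (iv) mixes geometrically from every initial law:
`|μKᵗ(A) - π_β(A)| ≤ (1 - e^{-M})ᵗ`.  [cite: Luscher2010Trivializing, §3.2 eq. (3.9), §4.1 eqs. (4.1)–(4.3),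
§4.3, §4.5(b)(c), §6] -/
theorem truncatedWilsonFlowSampler (d n N : ℕ) : ∃ b : ℝ, 0 ≤ b ∧
    ∀ (β : ℝ) (L : ℕ) [NeZero L] (B : SuBasis n) (Sk : ℕ → AmbConfig d L n → ℝ) (c : ℕ → ℝ),
      (∀ k, ContDiff ℝ ∞ (Sk k)) → IsLuscherSeries B (fun W => β * ambWilsonAction W) Sk c →
      ∀ (Φ : ℝ → GaugeConfig d L (Matrix.specialUnitaryGroup (Fin n) ℂ) →
          GaugeConfig d L (Matrix.specialUnitaryGroup (Fin n) ℂ)),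
        IsFlowMap (fun t W => -linkGrad B (truncFlowAction Sk t N) W) Φ →
      ∀ (q : Measure (GaugeConfig d L (Matrix.specialUnitaryGroup (Fin n) ℂ))) [IsProbabilityMeasure q],
        q = Measure.map (Φ 1) (trivialMeasure (Matrix.specialUnitaryGroup (Fin n) ℂ) d L) →
      ∀ M : ℝ, 2 * (|β| ^ (N + 2) * b * Fintype.card (Edge d L)) / (N + 2) ≤ M →
      ∃ w : GaugeConfig d L (Matrix.specialUnitaryGroup (Fin n) ℂ) → ℝ, Measurable w ∧
        (∀ U, Real.exp (-M) ≤ w U) ∧ (∀ U, w U ≤ Real.exp M) ∧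
        (q.withDensity fun U => ENNReal.ofReal (w U)) =
          boltzmannMeasure (fun U : GaugeConfig d L (Matrix.specialUnitaryGroup (Fin n) ℂ) =>
            β * ambWilsonAction (WilsonFlow.coeConfig U)) ∧
        Kernel.Invariant (indepMH q w)
          (boltzmannMeasure fun U : GaugeConfig d L (Matrix.specialUnitaryGroup (Fin n) ℂ) =>
            β * ambWilsonAction (WilsonFlow.coeConfig U)) ∧
        (∀ U, ENNReal.ofReal (Real.exp (-M)) ≤ imhAcceptMass q w U) ∧
        (∀ (U : GaugeConfig d L (Matrix.specialUnitaryGroup (Fin n) ℂ))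
          (A : Set (GaugeConfig d L (Matrix.specialUnitaryGroup (Fin n) ℂ))), MeasurableSet A →
          ENNReal.ofReal (Real.exp (-M)) *
              boltzmannMeasure (fun U : GaugeConfig d L (Matrix.specialUnitaryGroup (Fin n) ℂ) =>
                β * ambWilsonAction (WilsonFlow.coeConfig U)) A ≤ indepMH q w U A) ∧
        ∀ (μ : Measure (GaugeConfig d L (Matrix.specialUnitaryGroup (Fin n) ℂ))) [IsProbabilityMeasure μ]
          (t : ℕ) (A : Set (GaugeConfig d L (Matrix.specialUnitaryGroup (Fin n) ℂ))),
          |((fun m : Measure (GaugeConfig d L (Matrix.specialUnitaryGroup (Fin n) ℂ)) =>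
                m.bind (indepMH q w))^[t] μ).real A -
              (boltzmannMeasure fun U : GaugeConfig d L (Matrix.specialUnitaryGroup (Fin n) ℂ) =>
                β * ambWilsonAction (WilsonFlow.coeConfig U)).real A| ≤ (1 - Real.exp (-M)) ^ t := by
  obtain ⟨b, hb0, hb⟩ := exists_truncationDefect_bound d n N
  refine ⟨b, hb0, ?_⟩
  intro β L _ B Sk c hSk hser Φ hΦ q _ hq M hM
  have hS : ContDiff ℝ ∞ (fun W : AmbConfig d L n => β * ambWilsonAction W) :=
    contDiff_const.mul contDiff_ambWilsonAction
  have hF := contDiff_truncFlowAction_param hSk N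
  set K : ℝ := |β| ^ (N + 2) * b * Fintype.card (Edge d L) with hKdef
  have hK0 : 0 ≤ K := by positivity
  have hM0 : 0 ≤ M := by
    have : 0 ≤ 2 * K / (N + 2) := by positivity
    exact this.trans hM
  have hK : ∀ U : GaugeConfig d L (Matrix.specialUnitaryGroup (Fin n) ℂ),
      |luscherV B (fun W => β * ambWilsonAction W) (Sk N) (WilsonFlow.coeConfig U)| ≤ K :=
    hb β L B Sk c hSk hser
  have hg : IntervalIntegrable (fun t : ℝ => t ^ (N + 1) * K) volume 0 1 :=
    ((continuous_pow (N + 1)).mul continuous_const).intervalIntegrable 0 1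
  -- the pulled-back log-weight of the order-`N` map oscillates by at most `2K/(N+2) ≤ M`
  have hosc := logWeight_osc_le_of_defect_le B hS (F := fun t => truncFlowAction Sk t N) hF hΦ hg
    (fun t ht U => abs_truncation_defect_le B hS hSk hser N hK t ht U)
  have hoscM : ∀ V V' : GaugeConfig d L (Matrix.specialUnitaryGroup (Fin n) ℂ),
      |((∫ s in (0 : ℝ)..1, linkDiv B (fun W => -linkGrad B (truncFlowAction Sk s N) W)
            (WilsonFlow.coeConfig (Φ s V))) -
          β * ambWilsonAction (WilsonFlow.coeConfig (Φ 1 V))) -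
        ((∫ s in (0 : ℝ)..1, linkDiv B (fun W => -linkGrad B (truncFlowAction Sk s N) W)
            (WilsonFlow.coeConfig (Φ s V'))) -
          β * ambWilsonAction (WilsonFlow.coeConfig (Φ 1 V')))| ≤ M := fun V V' =>
    ((hosc V V').trans_eq (two_mul_intervalIntegral_pow_mul N K)).trans hM
  obtain ⟨w, hw, hlo, hhi, hπ, hinv, hacc, hdoeb⟩ :=
    flowSampler_exact_doeblin_of_osc jacobianFormula_holds B hS (F := fun t => truncFlowAction Sk t N)
      hF hΦ hoscM q hq
  refine ⟨w, hw, hlo, hhi, hπ, hinv, hacc, fun U A hA => hdoeb U hA, fun μ _ t A => ?_⟩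
  -- (iv) Doeblin ⇒ geometric convergence in total variation, set by set
  haveI : Fact (Measurable w) := ⟨hw⟩
  have hS'c : Continuous fun U : GaugeConfig d L (Matrix.specialUnitaryGroup (Fin n) ℂ) =>
      β * ambWilsonAction (WilsonFlow.coeConfig U) :=
    hS.continuous.comp WilsonFlow.continuous_coeConfig
  haveI := isProbabilityMeasure_boltzmannMeasure (d := d) (L := L) hS'c
  have hε1 : ENNReal.ofReal (Real.exp (-M)) ≤ 1 :=
    ENNReal.ofReal_le_one.2 (Real.exp_le_one_iff.2 (by linarith))
  have h := Literature.Probability.MarkovChains.Doeblin.doeblin_iterate_sub_invariant_le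
    (κ := indepMH q w) (ε := ENNReal.ofReal (Real.exp (-M)))
    (fun x B hB => hdoeb x hB) hε1 hinv μ t A
  rwa [ENNReal.toReal_ofReal (Real.exp_pos _).le] at h

/-- **Existence of the exact order-`N` Wilson-flow sampler with its certificate.**  With `b = b_N(d,n)` as
above, for every `β`, `L ≥ 1` and basis `B` there are: a global flow `𝓕` of `Z_t = -∂S̃^{[N]}_t` for the
CONSTRUCTED Lüscher series `β^{k+1} S̃_W^{(k)}` of `β S_W` (`wilsonSk`; Lüscher §4.4), its output law
`q = (𝓕_1)_* D[V]` (a probability measure) and a measurable weight `w`, such that `indepMH q w` is an EXACT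
sampler for `π_β = 𝒵⁻¹e^{-βS_W}D[U]` accepting from every configuration with probability
`≥ exp(-2|β|^{N+2} b |E|/(N+2))` and obeying Doeblin with that constant.
[cite: Luscher2010Trivializing, §3.1, §4.4 eq. (4.17), §4.5(c), §6] -/
theorem exists_truncatedWilsonFlowSampler (d n N : ℕ) : ∃ b : ℝ, 0 ≤ b ∧
    ∀ (β : ℝ) (L : ℕ) [NeZero L] (B : SuBasis n),
      ∃ (Φ : ℝ → GaugeConfig d L (Matrix.specialUnitaryGroup (Fin n) ℂ) →
          GaugeConfig d L (Matrix.specialUnitaryGroup (Fin n) ℂ))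
        (q : Measure (GaugeConfig d L (Matrix.specialUnitaryGroup (Fin n) ℂ)))
        (_ : IsProbabilityMeasure q) (w : GaugeConfig d L (Matrix.specialUnitaryGroup (Fin n) ℂ) → ℝ),
        IsFlowMap (fun t W => -linkGrad B
          (truncFlowAction (fun k W' => β ^ (k + 1) * wilsonSk d L B k W') t N) W) Φ ∧
        Continuous (fun p : ℝ × GaugeConfig d L (Matrix.specialUnitaryGroup (Fin n) ℂ) => Φ p.1 p.2) ∧
        q = Measure.map (Φ 1) (trivialMeasure (Matrix.specialUnitaryGroup (Fin n) ℂ) d L) ∧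
        Measurable w ∧
        (q.withDensity fun U => ENNReal.ofReal (w U)) =
          boltzmannMeasure (fun U : GaugeConfig d L (Matrix.specialUnitaryGroup (Fin n) ℂ) =>
            β * ambWilsonAction (WilsonFlow.coeConfig U)) ∧
        Kernel.Invariant (indepMH q w)
          (boltzmannMeasure fun U : GaugeConfig d L (Matrix.specialUnitaryGroup (Fin n) ℂ) =>
            β * ambWilsonAction (WilsonFlow.coeConfig U)) ∧
        (∀ U, ENNReal.ofReal (Real.exp (-(2 * (|β| ^ (N + 2) * b * Fintype.card (Edge d L)) / (N + 2)))) ≤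
          imhAcceptMass q w U) ∧
        ∀ (U : GaugeConfig d L (Matrix.specialUnitaryGroup (Fin n) ℂ))
          (A : Set (GaugeConfig d L (Matrix.specialUnitaryGroup (Fin n) ℂ))), MeasurableSet A →
          ENNReal.ofReal (Real.exp (-(2 * (|β| ^ (N + 2) * b * Fintype.card (Edge d L)) / (N + 2)))) *
              boltzmannMeasure (fun U : GaugeConfig d L (Matrix.specialUnitaryGroup (Fin n) ℂ) =>
                β * ambWilsonAction (WilsonFlow.coeConfig U)) A ≤ indepMH q w U A := by
  obtain ⟨b, hb0, hb⟩ := truncatedWilsonFlowSampler d n N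
  refine ⟨b, hb0, fun β L _ B => ?_⟩
  have hsm : ∀ k, ContDiff ℝ ∞ (fun W : AmbConfig d L n => β ^ (k + 1) * wilsonSk d L B k W) :=
    fun k => contDiff_const.mul (contDiff_wilsonSk B k)
  obtain ⟨Φ, hΦ, hcont, -, hprob⟩ := exists_isFlowMap_truncFlowAction B hsm N
  obtain ⟨w, hw, -, -, hπ, hinv, hacc, hdoeb, -⟩ := hb β L B _ _ hsm ((isLuscherSeries_wilsonSk B).smul β) Φ hΦ
    (Measure.map (Φ 1) (trivialMeasure (Matrix.specialUnitaryGroup (Fin n) ℂ) d L)) rfl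
    (2 * (|β| ^ (N + 2) * b * Fintype.card (Edge d L)) / (N + 2)) le_rfl
  exact ⟨Φ, _, hprob, w, hΦ, hcont, rfl, hw, hπ, hinv, hacc, hdoeb⟩

end Sampler

end Summit.Ventures.LatticeQCDFlow.TrivializingMaps
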